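import Summits.QuantumFields.YangMills.Theorems.BalabanUVNodesPortZDRecordChannelFibre
import Summits.QuantumFields.YangMills.Theorems.BalabanUVNodesN07RoadBHregChi29AxOfRecord
import Summits.QuantumFields.YangMills.Theorems.BalabanUVNodesN09GaugeFixingTermContinuousOnAdmissible
import Summits.QuantumFields.YangMills.Theorems.BalabanUVNodesN09FibreIntegralContinuousOfChartRegularity
import Literature.MathematicalPhysics.QuantumFieldTheory.Balaban1983to89.B11Thm1LevelZero

/-!
# NODE O port, row PT-A′ (PTZ-1, gen 5): the `k = 0` history-channel row of `PortZeroInputSplitZD` (26648) AT THE RECORD, RE-KEYED BY NAME TO NODE N09's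
# ROAD-B DOOR — its two located riders (ρ-b₀) ∕ (F) of gen 2 (`…PortZDRecordChannelFibre`, ✓p802473) SUPPLIED from the N07∕N09 Ax-edition door theorems, leaving
# displayed only the (P0-bridge) consumers `UkExists` ∕ `ContinuousOn (critCfgAxOfRecord …)` (or the two-radii [B11] binders), the (H-U) measurability letter, and NUMERICS

[Balaban1987RG1] = [I] (CMP 109, 1987): (0.13) p. 254, (0.17)–(0.19) p. 255, p. 259 (small-field domain, second form), (1.2) p. 260, (2.3) p. 265, (2.9) p. 266 and the
rider p. 266–267, (2.10) p. 267; [Balaban1985Variational] = [B11] (CMP 102): Thm 1 (6), (8) p. 279; [Balaban1985Averaging] = [B7] (CMP 98): Prop. 2 (53) p. 26;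
[Balaban1988RG2Cluster] = [II] p. 21.

Seat `ymgap-nodeO-port-PTZ-1` g5 (prover, HELPER MODE; director-ym №511 «GO (a)»; `--supports stmt-QuantumFields-27930 --as helper`; NO `--workitem`).

WHY.  Gen 2 proved the `k = 0` member of 26648's (L) clause at the record (`PortZDRecord.portZD_histChannel_at_zero_of_fibrewise`) from TWO LOCATED RIDERS on an open
set `U ∋ 1` of level-1 fields: (ρ-b₀) «every level-0 field in the support of the record's cut-off whose average lies in `U` is regular» and (F) «`U ⊆ regSetOfRecord K 0
ρ_0^{Ax}`».  Node N09's ROAD B (dag-n09-w1∕w2∕w3; Ax edition by dag-n07-w3, `…N07RoadBHregChi29AxOfRecord`) is exactly the machine producing both at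
`U := domAltOfRecord ν K 1`: (ρ-b₀) is its local SUPPORT clause `hρK_betaInput_chi29Ax_of_hsol_of_numerics` (fibre identity `avg_critCfgAxOfRecord` + [B7] Prop-2 smallness
+ the p. 267 rider numerics), (F) its door `domAlt_subset_regSetOfRecord_of_loopSmall_chi29Ax_local`.  After director-ym №509∕№510 the residual inputs of that road —
solvability `UkExists` on the small-field domain and continuity of the axialised minimiser `critCfgAxOfRecord` there — are precisely CONSUMERS OF P0 = «[B11] Thm 1 as a
named map» ((P0-rec) `Node00/BackgroundMapOfRecord` ✓p811606, (P0-bridge) `…N07P0FixedPointIsRecordMinimiser` ✓p811578), to be displayed BY NAME, never inlined.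
LOCATED (port record): `θ := thetaFill F a₀ ε₂₉` fills `θ.ν.ε₀ := 1` and `θ.ν.εreg := θ.εbg := a₀` (faces `theta13OfThm1CCMWZB_ε₀∕_εreg∕_εbg`, `rfl`), so (i) N07's
assembled one-step door `regularOn_domAlt_betaInput_chi29Ax_of_thm1_of_reg8` asks `GF_0` continuous on `domAlt_0 = {PlaqSmall 1}` — not available — whence §1 re-cuts
the door with the continuity set `Dk ⊇ «loops ≤ α ∧ plaquettes ≤ B»` a free OPEN set (at the record: `{PlaqSmall a₀}`, where `GF_0` IS continuous by dag-n09-w4's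
Federbush letter), and (ii) the two-radii binders must be taken at a free background radius `εbg > a₀` (§1 `…_of_thm1_of_reg8'`, §2 `…_of_thm1_of_reg8`).

WHAT IS PROVED (0 `sorry`; no `def` ∕ `instance` ∕ `notation`; standard axioms):
§1 (generic `N`, any transport `T`, any history `g`; ns `…Theorems.PortZD`)
* ★★ `regularOn_betaInput_chi29Ax_of_hsol_of_hcrit` — ONE STEP `j < K` OF ROAD B for the Ax β-input `ρ_j^{Ax} = χ^{(2.9)}_{j,ax}·e^{−GF_j∕g_j² + A_j}` with the two
  (P0-bridge) consumers DISPLAYED: `hsol : ∀ W ∈ domAlt_{j+1}, UkExists F N K (j+1) ν.εreg W`, `hcrit : ContinuousOn (critCfgAxOfRecord F N ν K j) domAlt_{j+1}`; plus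
  (H-U) `hρm`, (I19) `hint`, `GF_j`∕`A_j` continuous on an open `Dk ⊇` support set, NUMERICS.  Conclusion `domAlt_{j+1} ⊆ regSetOfRecord F N K j ρ_j^{Ax} ∧
  HasContTransportOn …`.  ★ `regularOn_betaInput_chi29Ax_of_thm1_of_reg8'` — the same with `hsol`∕`hcrit` DERIVED from the two-radii [B11] binders `h11`∕`hreg8` at a
  free `εbg > ν.εreg` (dag-n07-w3's `continuousOn_critCfgAxOfRecord_of_thm1_of_reg8`, dag-n09-w1's `ukExists_of_le_of_Uk_mem`).
* ★ `mem_bgReg_zero_of_chi29Ax_ne_zero` — THE p. 266–267 RIDER AT LEVEL 0: `avg V ∈ domAlt_1 → χ^{(2.9)}_{0,ax}(V) ≠ 0 → V ∈ bgReg_0(ε)` whenever the support bound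
  `B < ε` (`η_0 = 1`), from `hsol` + numerics.
* level-0 faces (`A_0 = −A∕g_0²` continuous is dag-n09's `N09FibreIntegralContinuousOfChartRegularity.continuous_effActionHT_zero`): `measurable_betaInput_chi29Ax_zero_of` ∕ `integrable_betaInput_chi29Ax_zero_of` (from the (H-U) letter
  `Measurable (critCfgAxOfRecord F N ν K 0)`; `|ρ_0| ≤ 1` on the compact field space), `continuousOn_gfOfRecord_plaqSmall` (`GF_k` continuous on `{PlaqSmall a}` under the
  Federbush letter `((d·L)²∕4)·a < δ_N^{Fed}`).
§2 (the record, `N = 2`, `θ := thetaFill F a₀ ε₂₉`, `k = 0`; ns `…Theorems.PortZDRecord`)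
* ★★ `recordGerm_zero_of_roadB` — the (L) difference functional VANISHES NEAR `B = 0` (`∀ᶠ B in 𝓝 0, recordΦfAx 0 v K B = recordΦzAx 0 v K B`) from: `hmeas` (H-U at level
  0), `hsol`, `hcrit` (P0 consumers on `domAlt_1`), NUMERICS in `a₀, ε₂₉, F.L` only — gen 2's riders (ρ-b₀)∕(F) both SUPPLIED (§1 at `j := 0`, `Dk := {PlaqSmall a₀}`).
* ★★ `formatPlusG_channel_zero_of_roadB`, ★★★ `portZD_histChannel_at_zero_of_roadB` — every format of the difference functional at the record slots, and THE `k := 0`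
  INSTANCE OF THE SIGNED (L) CLAUSE (binders verbatim), from the same g-FREE hypotheses (the cut-off is coupling-blind; (F)'s run-dependence through `A_0` is discharged).
* ★★ `recordGerm_zero_of_thm1_of_reg8` ∕ ★★★ `portZD_histChannel_at_zero_of_thm1_of_reg8` — the same keyed to the TWO-RADII [B11] BINDERS at a free `εbg > a₀`:
  `h11 : ∀ W ∈ domAlt_1, UkExists F 2 K 1 εbg W ∧ UniqueUkOrbit F 2 K 1 εbg W`, `hreg8 : ∀ W ∈ domAlt_1, Uk F 2 K 1 εbg W ∈ bgReg F 2 K 1 a₀` (N09's door binders).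

HONEST FRAMING.  Kernel assembly BY NAME over dag-n07-w3 ∕ dag-n09-w1…w5's Road-B theorems and this lineage's gen-2 rows; [B11] Theorem 1 ∕ P0 enter ONLY as displayed
hypotheses (`UkExists`, `UniqueUkOrbit`, (8)-membership, `ContinuousOn (critCfgAxOfRecord …)`), the (H-U) measurability letter stays displayed; NOTHING of Bałaban's
analysis is asserted, ported, discharged or refuted; no body of record edited; 26648 ∕ 27930⁸ SIGNED·OPEN (content-gated: (Z) = Thm 3's step at zero input, (L) = [II]
Lemma 3 for `k ≥ 1`; «(63)-half BLOCKED-ON P0 (α)+(β) ∕ everything-else XXL»), 27931 OPEN (implication-only on close), 27932 CLOSED; NODE O 0∕1; COUNT 8∕28 · K 1∕4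
UNMOVED; finite 𝕋⁴ at fixed ε — R4 closes the conditional rung `BalabanLadder.UV` only; NOT continuum ∕ OS ∕ Clay; the Yang–Mills mass gap is NOT proved by any of this.
-/

noncomputable section

open scoped Topology
open Set Filter MeasureTheory

/-! ## §1  Generic: N09's one-step Road-B door for the Ax β-input with the (P0-bridge) consumers displayed; the level-0 faces -/

namespace Summit.QuantumFields.YangMills.Theorems.PortZD

open Literature.MathematicalPhysics.QuantumFieldTheory.Balaban1983to89
open Literature.MathematicalPhysics.QuantumFieldTheory.Balaban1983to89.Node00
open Literature.MathematicalPhysics.QuantumFieldTheory.Balaban1983to89.T4Continuum (T4Family)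
open Literature.MathematicalPhysics.QuantumFieldTheory.Balaban1983to89.BlockAveraging (Idx loopHol)
open Literature.MathematicalPhysics.QuantumFieldTheory.Balaban1983to89.ExpMeanLog (deltaSU)
open Literature.MathematicalPhysics.QuantumFieldTheory.Balaban1983to89.FederbushMean (deltaFed)
open B12ContinuousTransportInvarianceOn (isOpen_domAltOfRecord continuous_dist1_SU continuous_plaqHol_SU)
open B12NodeKnitContinuousTransport (measurable_gfOfRecord gfOfRecord_nonneg integrable_of_bounded_measurable abs_integrand_le measurable_integrand)
open B12Eq019ActionBody (integrand wilsonTerm)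
open Summit.QuantumFields.YangMills.BalabanUVNodes.N07RoadBHregChi29AxOfRecord
  (betaInput_chi29Ax_apply betaInput_chi29Ax_nonneg hρc_betaInput_chi29Ax_local_of_continuousOn_crit hρC_betaInput_chi29Ax_of_continuousOn
    hρK_betaInput_chi29Ax_of_hsol_of_numerics domAlt_subset_regSetOfRecord_of_loopSmall_chi29Ax_local)
open Summit.QuantumFields.YangMills.BalabanUVNodes.N07CritCfgAxOfRecordClauses (measurable_chiFixed29Ax_of continuousOn_critCfgAxOfRecord_of_thm1_of_reg8)
open Summit.QuantumFields.YangMills.BalabanUVNodes.N09LocalSupportSetAtRecord (isClosed_loopLe_inter_plaqLe localSupportSet_subset_loopGuard plaqSmall_of_mem_of_lt)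
open Summit.QuantumFields.YangMills.BalabanUVNodes.N09GaugeFixingTermContinuousOnAdmissible (continuousOn_gfOfRecord_of_subset_admissible adm_stairHol_of_plaqSmall)
open Summit.QuantumFields.YangMills.BalabanUVNodes.N09BackgroundRadiiTransfer (ukExists_of_le_of_Uk_mem)

variable {F : T4Family} {N : ℕ} [NeZero N] {K : ℕ}

/-- ★★ **ONE STEP OF ROAD B FOR THE RE-CENTRED β-INPUT WITH THE (P0-bridge) CONSUMERS DISPLAYED BY NAME** (`χ := chiFixed29Ax ν ε₂₉`; ANY transport `T`, ANY history `g`;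
`j < K`): `domAlt_{j+1} ⊆ regSetOfRecord F N K j ρ_j^{Ax} ∧ HasContTransportOn F N K j ρ_j^{Ax} domAlt_{j+1}` from SOLVABILITY `hsol` at `ν.εreg` on `domAlt_{j+1}` and CONTINUITY
`hcrit` of the axialised minimiser `V^{(j)}_{ax} = critCfgAxOfRecord ν K j` there (the two P0 consumers), (H-U) `hρm`, (I19) `hint`, `GF_j` ∕ `A_j` continuous on an OPEN set `Dk`
containing the support set «loops ≤ α ∧ plaquettes ≤ B», `B = 2εreg∕L² + 4·max(ε₂₉, 10·((d+2)L)ε₂₉·L^{d−1})`, and NUMERICS (dag-n09-w2's one-step list).  N07's §4 assembly verbatim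
with `hsol`∕`hcrit` as inputs and `Dk` freed from `domAlt_j`. [cite: Balaban1987RG1, (0.13) p.254, (0.19) p.255, p.259, (2.3) p.265, (2.9) p.266, (2.10) p.267; Balaban1985Averaging, Prop. 2 (53) p.26; Balaban1985Variational, Thm 1 p.279] -/
theorem regularOn_betaInput_chi29Ax_of_hsol_of_hcrit (ν : Stage7Numerics) (ε₂₉ : ℝ) (K : ℕ) (g : ℕ → ℝ) (T : Transport F N) {j : ℕ} (hj : j < K)
    (hεreg : 0 < ν.εreg)
    (hε3 : (143 * (((((F.P K).d + 4 : ℕ) : ℝ)) ^ 2 / 4) ^ 2) * ν.εreg ≤ 1 / 3)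
    (hε2 : 2 * ν.εreg ≤ 2 * deltaSU (Fin N) / ((((F.P K).d + 4) * (F.P K).L : ℕ) : ℝ) ^ 2) (hε29 : 0 < ε₂₉)
    (hn1 : 1640 * (2 * (((((F.P K).d + 2) * (F.P K).L : ℕ) : ℝ) * ε₂₉) +
        ((((F.P K).d + 2) * (F.P K).L : ℕ) : ℝ) ^ 2 / 4 * (2 * ν.εreg / ((F.P K).L : ℝ) ^ 2)) * (((F.P K).L : ℝ) ^ ((F.P K).d - 1)) ^ 2 ≤ 1)
    (hn2 : 13 * (2 * (((((F.P K).d + 2) * (F.P K).L : ℕ) : ℝ) * ε₂₉) +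
        ((((F.P K).d + 2) * (F.P K).L : ℕ) : ℝ) ^ 2 / 4 * (2 * ν.εreg / ((F.P K).L : ℝ) ^ 2)) * ((F.P K).L : ℝ) ^ ((F.P K).d - 1) < deltaSU (Fin N))
    {α : ℝ} (hαB : ((((F.P K).d + 2) * (F.P K).L : ℕ) : ℝ) ^ 2 / 4 *
      (2 * ν.εreg / ((F.P K).L : ℝ) ^ 2 + 4 * max ε₂₉ (10 * (((((F.P K).d + 2) * (F.P K).L : ℕ) : ℝ) * ε₂₉) * ((F.P K).L : ℝ) ^ ((F.P K).d - 1))) < α)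
    (hα24 : α ≤ 1 / 24) (hαδ : α < deltaSU (Fin N)) (hαL : 157 * α < (((F.P K).L : ℝ) ^ ((F.P K).d - 1))⁻¹)
    {Dk : Set (GaugeField (F.P K) j (SU N))} (hDk : IsOpen Dk)
    (hBD : {W : GaugeField (F.P K) j (SU N) | (∀ c i, dist1 (loopHol W c i) ≤ α) ∧ ∀ p, dist1 (GaugeField.plaqHol W p) ≤
      2 * ν.εreg / ((F.P K).L : ℝ) ^ 2 + 4 * max ε₂₉ (10 * (((((F.P K).d + 2) * (F.P K).L : ℕ) : ℝ) * ε₂₉) * ((F.P K).L : ℝ) ^ ((F.P K).d - 1))} ⊆ Dk)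
    (hρm : Measurable (betaInputOfRecord F N T (chiFixed29Ax F N ν ε₂₉) K g j))
    (hint : Integrable (betaInputOfRecord F N T (chiFixed29Ax F N ν ε₂₉) K g j) (fieldMeasure (F.P K) j (SU N)))
    (hsol : ∀ W ∈ domAltOfRecord F N ν K (j + 1), UkExists F N K (j + 1) ν.εreg W)
    (hcrit : ContinuousOn (critCfgAxOfRecord F N ν K j) (domAltOfRecord F N ν K (j + 1)))
    (hGF : ContinuousOn (gfOfRecord F N K j) Dk)
    (hA : ContinuousOn (effActionHT F N T (chiFixed29Ax F N ν ε₂₉) K g j) Dk) :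
    domAltOfRecord F N ν K (j + 1) ⊆ regSetOfRecord F N K j (betaInputOfRecord F N T (chiFixed29Ax F N ν ε₂₉) K g j) ∧
      HasContTransportOn F N K j (betaInputOfRecord F N T (chiFixed29Ax F N ν ε₂₉) K g j) (domAltOfRecord F N ν K (j + 1)) :=
  domAlt_subset_regSetOfRecord_of_loopSmall_chi29Ax_local ν ν hj hα24 hαδ hαL hε29.ne' hρm hint (betaInput_chi29Ax_nonneg ν ε₂₉ T K g j)
    (isClosed_loopLe_inter_plaqLe _ _) (localSupportSet_subset_loopGuard (F := F) (N := N) K j)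
    (hρC_betaInput_chi29Ax_of_continuousOn ν ε₂₉ T g (isClosed_loopLe_inter_plaqLe _ _) hBD hGF hA)
    (hρK_betaInput_chi29Ax_of_hsol_of_numerics ν hj T g hε29.le hεreg hε3 hε2 hn1 hn2 hαB hsol)
    (hρc_betaInput_chi29Ax_local_of_continuousOn_crit ν ε₂₉ T g (isOpen_domAltOfRecord ν K (j + 1)) hDk hBD hαδ
      (localSupportSet_subset_loopGuard (F := F) (N := N) K j) hcrit hGF hA)

/-- ★ **THE SAME DOOR KEYED TO THE TWO-RADII [B11] BINDERS** at a free background radius `εbg > ν.εreg`: `h11` ([B11] Thm 1 ×2 at `εbg` on `domAlt_{j+1}`) and `hreg8` ((8)-membership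
`Uk εbg W ∈ bgReg ν.εreg`) give `hsol` down the radius (dag-n09-w1) and `hcrit` by dag-n07-w3's `continuousOn_critCfgAxOfRecord_of_thm1_of_reg8` (its numerics `α₀`, `δ` displayed);
`Dk` free as above. [cite: Balaban1987RG1, p.259, (2.3) p.265, (2.9) p.266, (2.10) p.267; Balaban1985Variational, Thm 1 (6), (8) p.279; Balaban1985Averaging, Prop. 2 (53) p.26] -/
theorem regularOn_betaInput_chi29Ax_of_thm1_of_reg8' (ν : Stage7Numerics) (ε₂₉ : ℝ) (K : ℕ) (g : ℕ → ℝ) (T : Transport F N) {j : ℕ} (hj : j < K)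
    (hεreg : 0 < ν.εreg)
    (hε3 : (143 * (((((F.P K).d + 4 : ℕ) : ℝ)) ^ 2 / 4) ^ 2) * ν.εreg ≤ 1 / 3)
    (hε2 : 2 * ν.εreg ≤ 2 * deltaSU (Fin N) / ((((F.P K).d + 4) * (F.P K).L : ℕ) : ℝ) ^ 2) (hε29 : 0 < ε₂₉)
    (hn1 : 1640 * (2 * (((((F.P K).d + 2) * (F.P K).L : ℕ) : ℝ) * ε₂₉) +
        ((((F.P K).d + 2) * (F.P K).L : ℕ) : ℝ) ^ 2 / 4 * (2 * ν.εreg / ((F.P K).L : ℝ) ^ 2)) * (((F.P K).L : ℝ) ^ ((F.P K).d - 1)) ^ 2 ≤ 1)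
    (hn2 : 13 * (2 * (((((F.P K).d + 2) * (F.P K).L : ℕ) : ℝ) * ε₂₉) +
        ((((F.P K).d + 2) * (F.P K).L : ℕ) : ℝ) ^ 2 / 4 * (2 * ν.εreg / ((F.P K).L : ℝ) ^ 2)) * ((F.P K).L : ℝ) ^ ((F.P K).d - 1) < deltaSU (Fin N))
    {α : ℝ} (hαB : ((((F.P K).d + 2) * (F.P K).L : ℕ) : ℝ) ^ 2 / 4 *
      (2 * ν.εreg / ((F.P K).L : ℝ) ^ 2 + 4 * max ε₂₉ (10 * (((((F.P K).d + 2) * (F.P K).L : ℕ) : ℝ) * ε₂₉) * ((F.P K).L : ℝ) ^ ((F.P K).d - 1))) < α)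
    (hα24 : α ≤ 1 / 24) (hαδ : α < deltaSU (Fin N)) (hαL : 157 * α < (((F.P K).L : ℝ) ^ ((F.P K).d - 1))⁻¹)
    {εbg α₀ δ : ℝ} (hlt : ν.εreg < εbg) (he : ν.εreg < α₀) (hα : 0 < α₀)
    (hα3 : (143 * (((((F.P K).d + 4 : ℕ) : ℝ)) ^ 2 / 4) ^ 2) * α₀ ≤ 1 / 3)
    (hα2 : 2 * α₀ ≤ 2 * deltaSU (Fin N) / ((((F.P K).d + 4) * (F.P K).L : ℕ) : ℝ) ^ 2)
    (hα24' : ((((F.P K).d + 2) * (F.P K).L : ℕ) : ℝ) ^ 2 / 4 * (2 * α₀) ≤ 1 / 24)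
    (hαL' : 157 * (((((F.P K).d + 2) * (F.P K).L : ℕ) : ℝ) ^ 2 / 4 * (2 * α₀)) < (((F.P K).L : ℝ) ^ ((F.P K).d - 1))⁻¹)
    (hδ : 2 * ν.εreg ≤ δ * ((F.P K).L : ℝ) ^ 2) (hfed : ((((F.P K).d * (F.P K).L : ℕ) : ℝ)) ^ 2 / 4 * δ < deltaFed (Fin N))
    {Dk : Set (GaugeField (F.P K) j (SU N))} (hDk : IsOpen Dk)
    (hBD : {W : GaugeField (F.P K) j (SU N) | (∀ c i, dist1 (loopHol W c i) ≤ α) ∧ ∀ p, dist1 (GaugeField.plaqHol W p) ≤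
      2 * ν.εreg / ((F.P K).L : ℝ) ^ 2 + 4 * max ε₂₉ (10 * (((((F.P K).d + 2) * (F.P K).L : ℕ) : ℝ) * ε₂₉) * ((F.P K).L : ℝ) ^ ((F.P K).d - 1))} ⊆ Dk)
    (hρm : Measurable (betaInputOfRecord F N T (chiFixed29Ax F N ν ε₂₉) K g j))
    (hint : Integrable (betaInputOfRecord F N T (chiFixed29Ax F N ν ε₂₉) K g j) (fieldMeasure (F.P K) j (SU N)))
    (h11 : ∀ W ∈ domAltOfRecord F N ν K (j + 1), UkExists F N K (j + 1) εbg W ∧ UniqueUkOrbit F N K (j + 1) εbg W)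
    (hreg8 : ∀ W ∈ domAltOfRecord F N ν K (j + 1), Uk F N K (j + 1) εbg W ∈ bgReg F N K (j + 1) ν.εreg)
    (hGF : ContinuousOn (gfOfRecord F N K j) Dk)
    (hA : ContinuousOn (effActionHT F N T (chiFixed29Ax F N ν ε₂₉) K g j) Dk) :
    domAltOfRecord F N ν K (j + 1) ⊆ regSetOfRecord F N K j (betaInputOfRecord F N T (chiFixed29Ax F N ν ε₂₉) K g j) ∧
      HasContTransportOn F N K j (betaInputOfRecord F N T (chiFixed29Ax F N ν ε₂₉) K g j) (domAltOfRecord F N ν K (j + 1)) :=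
  regularOn_betaInput_chi29Ax_of_hsol_of_hcrit ν ε₂₉ K g T hj hεreg hε3 hε2 hε29 hn1 hn2 hαB hα24 hαδ hαL hDk hBD hρm hint
    (fun W hW => ukExists_of_le_of_Uk_mem hlt.le (h11 W hW).1 (hreg8 W hW))
    (continuousOn_critCfgAxOfRecord_of_thm1_of_reg8 ν hj hlt he hα hα3 hα2 hα24' hαL' hεreg hε3 hε2 hδ hfed h11 hreg8) hGF hA

/-- ★ **THE p. 266–267 RIDER AT LEVEL 0 FROM SOLVABILITY + NUMERICS** (`η_0 = 1`): a level-0 field whose one-step average lies in the small-field domain `domAlt_1` and at which the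
re-centred cut-off `χ^{(2.9)}_{0,ax}` is non-zero has ALL plaquette variables `< ε` (hence lies in `bgReg_0(ε)`), as soon as the support bound `B < ε` — N07's support clause
`hρK_betaInput_chi29Ax_of_hsol_of_numerics` (`χ ≠ 0 ⇒ ρ_0^{Ax} ≠ 0`; the interior of «loops ≤ α ∧ plaquettes ≤ B»). [cite: Balaban1987RG1, (2.9) p.266–267, (1.2) p.260; Balaban1985Averaging, Prop. 2 (53) p.26] -/
theorem mem_bgReg_zero_of_chi29Ax_ne_zero (ν : Stage7Numerics) (hK : 0 < K) (g : ℕ → ℝ) {ε₂₉ : ℝ} (hε29 : 0 ≤ ε₂₉) (hεreg : 0 < ν.εreg)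
    (hε3 : (143 * (((((F.P K).d + 4 : ℕ) : ℝ)) ^ 2 / 4) ^ 2) * ν.εreg ≤ 1 / 3)
    (hε2 : 2 * ν.εreg ≤ 2 * deltaSU (Fin N) / ((((F.P K).d + 4) * (F.P K).L : ℕ) : ℝ) ^ 2)
    (hn1 : 1640 * (2 * (((((F.P K).d + 2) * (F.P K).L : ℕ) : ℝ) * ε₂₉) +
        ((((F.P K).d + 2) * (F.P K).L : ℕ) : ℝ) ^ 2 / 4 * (2 * ν.εreg / ((F.P K).L : ℝ) ^ 2)) * (((F.P K).L : ℝ) ^ ((F.P K).d - 1)) ^ 2 ≤ 1)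
    (hn2 : 13 * (2 * (((((F.P K).d + 2) * (F.P K).L : ℕ) : ℝ) * ε₂₉) +
        ((((F.P K).d + 2) * (F.P K).L : ℕ) : ℝ) ^ 2 / 4 * (2 * ν.εreg / ((F.P K).L : ℝ) ^ 2)) * ((F.P K).L : ℝ) ^ ((F.P K).d - 1) < deltaSU (Fin N))
    {α : ℝ} (hαB : ((((F.P K).d + 2) * (F.P K).L : ℕ) : ℝ) ^ 2 / 4 *
      (2 * ν.εreg / ((F.P K).L : ℝ) ^ 2 + 4 * max ε₂₉ (10 * (((((F.P K).d + 2) * (F.P K).L : ℕ) : ℝ) * ε₂₉) * ((F.P K).L : ℝ) ^ ((F.P K).d - 1))) < α)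
    (hsol : ∀ W ∈ domAltOfRecord F N ν K 1, UkExists F N K 1 ν.εreg W) {ε : ℝ}
    (hBε : 2 * ν.εreg / ((F.P K).L : ℝ) ^ 2 + 4 * max ε₂₉ (10 * (((((F.P K).d + 2) * (F.P K).L : ℕ) : ℝ) * ε₂₉) * ((F.P K).L : ℝ) ^ ((F.P K).d - 1)) < ε) :
    ∀ V : GaugeField (F.P K) 0 (SU N), (avOfRecord F N K 0).avg V ∈ domAltOfRecord F N ν K 1 →
      chiFixed29Ax F N ν ε₂₉ K g 0 V ≠ 0 → V ∈ bgReg F N K 0 ε := by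
  intro V hV hχ
  have hρ : betaInputOfRecord F N (TcanOfRecord F N) (chiFixed29Ax F N ν ε₂₉) K g 0 V ≠ 0 := by
    rw [betaInput_chi29Ax_apply]
    exact mul_ne_zero hχ (Real.exp_pos _).ne'
  have hmem := interior_subset (hρK_betaInput_chi29Ax_of_hsol_of_numerics ν hK (TcanOfRecord F N) g hε29 hεreg hε3 hε2 hn1 hn2 hαB hsol V hV hρ)
  rw [mem_bgReg_iff, B11Thm1LevelZero.eta_zero, one_pow, mul_one]
  exact plaqSmall_of_mem_of_lt hBε V hmem

/-- (H-U) ⇒ the level-0 Ax β-input `ρ_0^{Ax} = χ^{(2.9)}_{0,ax}·e^{−GF_0∕g_0² + A_0}` is measurable (the cut-off is measurable as soon as the axialised minimiser is —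
dag-n07-w3's `measurable_chiFixed29Ax_of`; `GF_0`, `A_0` measurable). [cite: Balaban1987RG1, (0.19) p.255, (2.9) p.266] -/
theorem measurable_betaInput_chi29Ax_zero_of (ν : Stage7Numerics) (ε₂₉ : ℝ) (T : Transport F N) (K : ℕ) (g : ℕ → ℝ)
    (hmeas : Measurable (critCfgAxOfRecord F N ν K 0)) :
    Measurable (betaInputOfRecord F N T (chiFixed29Ax F N ν ε₂₉) K g 0) := by
  show Measurable (integrand (chiFixed29Ax F N ν ε₂₉ K g 0) (gfOfRecord F N K 0) (g 0) (effActionHT F N T (chiFixed29Ax F N ν ε₂₉) K g 0))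
  rw [effActionHT_zero]
  exact measurable_integrand (measurable_chiFixed29Ax_of ε₂₉ g hmeas) (measurable_gfOfRecord K 0)
    (T4WilsonResponseJunction.measurable_neg_mul_wilsonAction _ _) (g 0)

/-- (H-U) ⇒ (I19) at level 0: the level-0 Ax β-input is integrable for product Haar measure (`0 ≤ χ ≤ 1`, `GF_0 ≥ 0`, `A_0 = −A∕g_0² ≤ 0`, so `|ρ_0| ≤ 1`; it reads no
transport). [cite: Balaban1987RG1, (0.17)–(0.19) p.255] -/
theorem integrable_betaInput_chi29Ax_zero_of (ν : Stage7Numerics) (ε₂₉ : ℝ) (T : Transport F N) (K : ℕ) (g : ℕ → ℝ)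
    (hmeas : Measurable (critCfgAxOfRecord F N ν K 0)) :
    Integrable (betaInputOfRecord F N T (chiFixed29Ax F N ν ε₂₉) K g 0) (fieldMeasure (F.P K) 0 (SU N)) := by
  have hm := measurable_betaInput_chi29Ax_zero_of ν ε₂₉ T K g hmeas
  refine integrable_of_bounded_measurable hm (C := 1) fun U => ?_
  show |integrand (chiFixed29Ax F N ν ε₂₉ K g 0) (gfOfRecord F N K 0) (g 0) (effActionHT F N T (chiFixed29Ax F N ν ε₂₉) K g 0) U| ≤ 1
  rw [effActionHT_zero]
  refine abs_integrand_le (fun V => ?_) (fun V => ?_) (gfOfRecord_nonneg K 0) (g 0) (B := 1) (fun V => ?_) U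
  · rcases chiFixed29Ax_eq_zero_or_one ν ε₂₉ K g 0 V with h | h <;> rw [h]
    exact zero_le_one
  · rcases chiFixed29Ax_eq_zero_or_one ν ε₂₉ K g 0 V with h | h <;> rw [h]
    exact zero_le_one
  · rw [B12Eq019ActionBody.wilsonTerm_apply]
    refine Real.exp_le_one_iff.2 ?_
    have hA : 0 ≤ wilsonAction 1 V := wilsonAction4_nonneg V
    have : 0 ≤ 1 / g 0 ^ 2 * wilsonAction 1 V := mul_nonneg (one_div_nonneg.2 (sq_nonneg _)) hA
    linarith

/-- The strict plaquette-smallness set `{U | |U(∂p) − 1| < a ∀ p}` is open (finitely many strict inequalities of continuous functions). [cite: Balaban1987RG1, p.259 (bookkeeping)] -/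
theorem isOpen_setOf_plaqSmall (j : ℕ) (a : ℝ) : IsOpen {U : GaugeField (F.P K) j (SU N) | PlaqSmall a U} := by
  have h : {U : GaugeField (F.P K) j (SU N) | PlaqSmall a U} = ⋂ p : Plaq (F.P K) j, {U | dist1 (GaugeField.plaqHol U p) < a} := by
    ext U; simp only [PlaqSmall, mem_setOf_eq, mem_iInter]
  rw [h]
  exact isOpen_iInter_of_finite fun p => isOpen_lt (continuous_dist1_SU.comp (continuous_plaqHol_SU p)) continuous_const

/-- **`GF_k` IS CONTINUOUS ON `{PlaqSmall a}` UNDER THE FEDERBUSH LETTER** `((d·L)²∕4)·a < δ_N^{Fed}`, `0 ≤ a` (dag-n09-w4's admissible-set continuity + `adm_stairHol_of_plaqSmall`).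
[cite: Balaban1987RG1, (0.17) p.255 (the gauge-fixing term), p.259] -/
theorem continuousOn_gfOfRecord_plaqSmall {k : ℕ} (hk : k + 1 ≤ (F.P K).m + (F.P K).K) {a : ℝ} (ha : 0 ≤ a)
    (hnum : ((((F.P K).d * (F.P K).L : ℕ) : ℝ)) ^ 2 / 4 * a < deltaFed (Fin N)) :
    ContinuousOn (gfOfRecord F N K k) {U : GaugeField (F.P K) k (SU N) | PlaqSmall a U} :=
  continuousOn_gfOfRecord_of_subset_admissible K k fun _ hU y _ hx => adm_stairHol_of_plaqSmall hk ha hU hnum y hx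

end Summit.QuantumFields.YangMills.Theorems.PortZD

/-! ## §2  The record, `k = 0`: gen 2's rows with (ρ-b₀) and (F) supplied by §1 -/

namespace Summit.QuantumFields.YangMills.Theorems.PortZDRecord

open Literature.MathematicalPhysics.QuantumFieldTheory.Balaban1983to89
open Literature.MathematicalPhysics.QuantumFieldTheory.Balaban1983to89.Node00
open Literature.MathematicalPhysics.QuantumFieldTheory.Balaban1983to89.T4Continuum (T4Family)
open Literature.MathematicalPhysics.QuantumFieldTheory.Balaban1983to89.BlockAveraging (Idx loopHol)
open Literature.MathematicalPhysics.QuantumFieldTheory.Balaban1983to89.ExpMeanLog (deltaSU)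
open Literature.MathematicalPhysics.QuantumFieldTheory.Balaban1983to89.FederbushMean (deltaFed)
open Literature.MathematicalPhysics.QuantumFieldTheory.Balaban1983to89.B12FormatPlus (FormatPlusG)
open B12ContinuousTransportInvarianceOn (isOpen_domAltOfRecord)
open Summit.QuantumFields.YangMills.Theorems.K0RecordFormatNames
open Summit.QuantumFields.YangMills.BalabanUVNodes.N09LocalSupportSetAtRecord (plaqSmall_of_mem_of_lt)

variable (F : T4Family) (a₀ ε₂₉ : ℝ)

/-- ★★ **THE GERM AT THE RECORD FROM N09's ROAD-B DOOR** (`θ := thetaFill F a₀ ε₂₉`: `θ.ν.εreg = θ.εbg = a₀`, `θ.ν.ε₀ = 1`, `θ.ε₂₉ = ε₂₉`; `0 < K`; history `v`): IF (H-U) the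
axialised level-0 minimiser `critCfgAxOfRecord θ.ν K 0` is measurable, (P0 ×2) every level-1 field of the small-field domain `domAlt_1` is solvable at radius `a₀` and
`critCfgAxOfRecord θ.ν K 0` is continuous ON `domAlt_1`, and the NUMERICS below hold (`B := 2a₀∕L² + 4·max(ε₂₉, 60L·ε₂₉·L³)` the support bound: `B < a₀`, `((6L)²∕4)·B < α ≤ 1∕24`,
`α < δ_2`, `157α < L^{−3}`, rider ×2, (53) ×2 at `a₀`, Federbush `(4L)²∕4·a₀ < δ_2^{Fed}`), THEN `∀ᶠ B in 𝓝 0, recordΦfAx 0 v K B = recordΦzAx 0 v K B` — gen 2's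
`recordGerm_zero_of_fibrewise` at `U := domAlt_1` with (ρ-b₀) := `PortZD.mem_bgReg_zero_of_chi29Ax_ne_zero` and (F) := `PortZD.regularOn_betaInput_chi29Ax_of_hsol_of_hcrit`
(`j := 0`, `Dk := {PlaqSmall a₀}`, where `GF_0` and `A_0` are continuous). [cite: Balaban1987RG1, (0.17) p.255, (0.13) p.254, p.259, (2.9) p.266–267, (2.10) p.267; Balaban1985Variational, Thm 1 p.279] -/
theorem recordGerm_zero_of_roadB (ha₀ : 0 < a₀) (hε29 : 0 < ε₂₉) {K : ℕ} (hK : 0 < K) (v : Fin 1 → ℝ)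
    (hε3 : (143 * ((((8 : ℕ) : ℝ)) ^ 2 / 4) ^ 2) * a₀ ≤ 1 / 3)
    (hε2 : 2 * a₀ ≤ 2 * deltaSU (Fin 2) / (((8 * F.L : ℕ) : ℝ)) ^ 2)
    (hn1 : 1640 * (2 * ((((6 * F.L : ℕ) : ℝ)) * ε₂₉) + (((6 * F.L : ℕ) : ℝ)) ^ 2 / 4 * (2 * a₀ / (F.L : ℝ) ^ 2)) * (((F.L : ℝ) ^ 3)) ^ 2 ≤ 1)
    (hn2 : 13 * (2 * ((((6 * F.L : ℕ) : ℝ)) * ε₂₉) + (((6 * F.L : ℕ) : ℝ)) ^ 2 / 4 * (2 * a₀ / (F.L : ℝ) ^ 2)) * (F.L : ℝ) ^ 3 < deltaSU (Fin 2))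
    {α : ℝ} (hαB : (((6 * F.L : ℕ) : ℝ)) ^ 2 / 4 * (2 * a₀ / (F.L : ℝ) ^ 2 + 4 * max ε₂₉ (10 * ((((6 * F.L : ℕ) : ℝ)) * ε₂₉) * (F.L : ℝ) ^ 3)) < α)
    (hα24 : α ≤ 1 / 24) (hαδ : α < deltaSU (Fin 2)) (hαL : 157 * α < ((F.L : ℝ) ^ 3)⁻¹)
    (hBa : 2 * a₀ / (F.L : ℝ) ^ 2 + 4 * max ε₂₉ (10 * ((((6 * F.L : ℕ) : ℝ)) * ε₂₉) * (F.L : ℝ) ^ 3) < a₀)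
    (hfed : (((4 * F.L : ℕ) : ℝ)) ^ 2 / 4 * a₀ < deltaFed (Fin 2))
    (hmeas : Measurable (critCfgAxOfRecord F 2 (thetaFill F a₀ ε₂₉).ν K 0))
    (hsol : ∀ W ∈ domAltOfRecord F 2 (thetaFill F a₀ ε₂₉).ν K 1, UkExists F 2 K 1 a₀ W)
    (hcrit : ContinuousOn (critCfgAxOfRecord F 2 (thetaFill F a₀ ε₂₉).ν K 0) (domAltOfRecord F 2 (thetaFill F a₀ ε₂₉).ν K 1)) :
    letI θ := thetaFill F a₀ ε₂₉
    letI := θ.instVβ₁; letI := θ.instVβ₂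
    ∀ᶠ B in 𝓝 (0 : recordW F a₀ ε₂₉ 0 K), recordΦfAx F a₀ ε₂₉ 0 v K B = recordΦzAx F a₀ ε₂₉ 0 v K B := by
  -- the filled numerics, by their faces (`rfl`), re-read in the `(F.P K)`-letters of the N07∕N09 doors (`d = 4`, `(F.P K).L = F.L`)
  have hνreg : (thetaFill F a₀ ε₂₉).ν.εreg = a₀ := rfl
  have hν0 : (thetaFill F a₀ ε₂₉).ν.ε₀ = 1 := rfl
  have hk1 : 0 + 1 ≤ (F.P K).m + (F.P K).K := by simp only [T4Family.P_K]; omega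
  have hε3' : (143 * (((((F.P K).d + 4 : ℕ) : ℝ)) ^ 2 / 4) ^ 2) * (thetaFill F a₀ ε₂₉).ν.εreg ≤ 1 / 3 := by
    simpa only [hνreg, T4Family.P_d, T4Family.P_L, Nat.reduceAdd] using hε3
  have hε2' : 2 * (thetaFill F a₀ ε₂₉).ν.εreg ≤ 2 * deltaSU (Fin 2) / ((((F.P K).d + 4) * (F.P K).L : ℕ) : ℝ) ^ 2 := by
    simpa only [hνreg, T4Family.P_d, T4Family.P_L, Nat.reduceAdd] using hε2
  have hn1' : 1640 * (2 * (((((F.P K).d + 2) * (F.P K).L : ℕ) : ℝ) * ε₂₉) +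
      ((((F.P K).d + 2) * (F.P K).L : ℕ) : ℝ) ^ 2 / 4 * (2 * (thetaFill F a₀ ε₂₉).ν.εreg / ((F.P K).L : ℝ) ^ 2)) *
        (((F.P K).L : ℝ) ^ ((F.P K).d - 1)) ^ 2 ≤ 1 := by
    simpa only [hνreg, T4Family.P_d, T4Family.P_L, Nat.reduceAdd, Nat.reduceSub] using hn1
  have hn2' : 13 * (2 * (((((F.P K).d + 2) * (F.P K).L : ℕ) : ℝ) * ε₂₉) +
      ((((F.P K).d + 2) * (F.P K).L : ℕ) : ℝ) ^ 2 / 4 * (2 * (thetaFill F a₀ ε₂₉).ν.εreg / ((F.P K).L : ℝ) ^ 2)) *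
        ((F.P K).L : ℝ) ^ ((F.P K).d - 1) < deltaSU (Fin 2) := by
    simpa only [hνreg, T4Family.P_d, T4Family.P_L, Nat.reduceAdd, Nat.reduceSub] using hn2
  have hαB' : ((((F.P K).d + 2) * (F.P K).L : ℕ) : ℝ) ^ 2 / 4 * (2 * (thetaFill F a₀ ε₂₉).ν.εreg / ((F.P K).L : ℝ) ^ 2 +
      4 * max ε₂₉ (10 * (((((F.P K).d + 2) * (F.P K).L : ℕ) : ℝ) * ε₂₉) * ((F.P K).L : ℝ) ^ ((F.P K).d - 1))) < α := by
    simpa only [hνreg, T4Family.P_d, T4Family.P_L, Nat.reduceAdd, Nat.reduceSub] using hαB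
  have hαL' : 157 * α < (((F.P K).L : ℝ) ^ ((F.P K).d - 1))⁻¹ := by
    simpa only [T4Family.P_d, T4Family.P_L, Nat.reduceSub] using hαL
  have hBa' : 2 * (thetaFill F a₀ ε₂₉).ν.εreg / ((F.P K).L : ℝ) ^ 2 +
      4 * max ε₂₉ (10 * (((((F.P K).d + 2) * (F.P K).L : ℕ) : ℝ) * ε₂₉) * ((F.P K).L : ℝ) ^ ((F.P K).d - 1)) < a₀ := by
    simpa only [hνreg, T4Family.P_d, T4Family.P_L, Nat.reduceAdd, Nat.reduceSub] using hBa
  have hfed' : ((((F.P K).d * (F.P K).L : ℕ) : ℝ)) ^ 2 / 4 * a₀ < deltaFed (Fin 2) := by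
    simpa only [T4Family.P_d, T4Family.P_L] using hfed
  have hsol' : ∀ W ∈ domAltOfRecord F 2 (thetaFill F a₀ ε₂₉).ν K 1, UkExists F 2 K 1 (thetaFill F a₀ ε₂₉).ν.εreg W := by
    rw [hνreg]; exact hsol
  -- the open set `U := domAlt_1 ∋ 1`
  refine recordGerm_zero_of_fibrewise F a₀ ε₂₉ ha₀ hK v (isOpen_domAltOfRecord (thetaFill F a₀ ε₂₉).ν K 1)
    (one_mem_domAltOfRecord (thetaFill F a₀ ε₂₉).ν (by rw [hν0]; exact one_pos) K 1) ?_ ?_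
  · -- (ρ-b₀): the p. 266–267 rider from N07's support clause
    intro V hV hχ
    exact PortZD.mem_bgReg_zero_of_chi29Ax_ne_zero (thetaFill F a₀ ε₂₉).ν hK (T4FlagMemory.extd v) hε29.le (by rw [hνreg]; exact ha₀)
      hε3' hε2' hn1' hn2' hαB' hsol' hBa' V hV hχ
  · -- (F): the door at `j := 0`, continuity set `{PlaqSmall a₀}`
    have hBD : {W : GaugeField (F.P K) 0 (SU 2) | (∀ c i, dist1 (loopHol W c i) ≤ α) ∧ ∀ p, dist1 (GaugeField.plaqHol W p) ≤
        2 * (thetaFill F a₀ ε₂₉).ν.εreg / ((F.P K).L : ℝ) ^ 2 +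
          4 * max ε₂₉ (10 * (((((F.P K).d + 2) * (F.P K).L : ℕ) : ℝ) * ε₂₉) * ((F.P K).L : ℝ) ^ ((F.P K).d - 1))} ⊆
        {U : GaugeField (F.P K) 0 (SU 2) | PlaqSmall a₀ U} :=
      fun U hU => plaqSmall_of_mem_of_lt hBa' U hU
    exact (PortZD.regularOn_betaInput_chi29Ax_of_hsol_of_hcrit (thetaFill F a₀ ε₂₉).ν ε₂₉ K (T4FlagMemory.extd v) (TcanOfRecord F 2) hK
      (by rw [hνreg]; exact ha₀) hε3' hε2' hε29 hn1' hn2' hαB' hα24 hαδ hαL' (PortZD.isOpen_setOf_plaqSmall 0 a₀) hBD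
      (PortZD.measurable_betaInput_chi29Ax_zero_of _ ε₂₉ _ K _ hmeas) (PortZD.integrable_betaInput_chi29Ax_zero_of _ ε₂₉ _ K _ hmeas)
      hsol' hcrit (PortZD.continuousOn_gfOfRecord_plaqSmall hk1 ha₀.le hfed')
      (Summit.QuantumFields.YangMills.BalabanUVNodes.N09FibreIntegralContinuousOfChartRegularity.continuous_effActionHT_zero
        (TcanOfRecord F 2) _ K _).continuousOn).1


/-- ★★ **EVERY FORMAT `E ≥ 0` OF THE DIFFERENCE FUNCTIONAL AT THE RECORD SLOTS, `k = 0`, FROM THE ROAD-B INPUTS** asked at every member of the shifted family `n ↦ K₀ + n`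
((H-U) `hmeas`, the two P0 consumers `hsol` ∕ `hcrit` on `domAlt_1`; the numerics are torus-independent: `d = 4`, `(F.P K).L = F.L`), `0 < a₀`, `0 < ε₂₉`, `0 < K₀`.
[cite: Balaban1987RG1, (0.17) p.255, (1.18)–(1.19) p.263, (2.9) p.266–267, p.259; Balaban1988RG2Cluster, p.21] -/
theorem formatPlusG_channel_zero_of_roadB (ha₀ : 0 < a₀) (hε29 : 0 < ε₂₉) (Mc K₀ : ℕ) (hK₀ : 0 < K₀) (α₀ α₁ κ E : ℝ) (hE : 0 ≤ E) (v : Fin 1 → ℝ)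
    (hε3 : (143 * ((((8 : ℕ) : ℝ)) ^ 2 / 4) ^ 2) * a₀ ≤ 1 / 3)
    (hε2 : 2 * a₀ ≤ 2 * deltaSU (Fin 2) / (((8 * F.L : ℕ) : ℝ)) ^ 2)
    (hn1 : 1640 * (2 * ((((6 * F.L : ℕ) : ℝ)) * ε₂₉) + (((6 * F.L : ℕ) : ℝ)) ^ 2 / 4 * (2 * a₀ / (F.L : ℝ) ^ 2)) * (((F.L : ℝ) ^ 3)) ^ 2 ≤ 1)
    (hn2 : 13 * (2 * ((((6 * F.L : ℕ) : ℝ)) * ε₂₉) + (((6 * F.L : ℕ) : ℝ)) ^ 2 / 4 * (2 * a₀ / (F.L : ℝ) ^ 2)) * (F.L : ℝ) ^ 3 < deltaSU (Fin 2))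
    {α : ℝ} (hαB : (((6 * F.L : ℕ) : ℝ)) ^ 2 / 4 * (2 * a₀ / (F.L : ℝ) ^ 2 + 4 * max ε₂₉ (10 * ((((6 * F.L : ℕ) : ℝ)) * ε₂₉) * (F.L : ℝ) ^ 3)) < α)
    (hα24 : α ≤ 1 / 24) (hαδ : α < deltaSU (Fin 2)) (hαL : 157 * α < ((F.L : ℝ) ^ 3)⁻¹)
    (hBa : 2 * a₀ / (F.L : ℝ) ^ 2 + 4 * max ε₂₉ (10 * ((((6 * F.L : ℕ) : ℝ)) * ε₂₉) * (F.L : ℝ) ^ 3) < a₀)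
    (hfed : (((4 * F.L : ℕ) : ℝ)) ^ 2 / 4 * a₀ < deltaFed (Fin 2))
    (hmeas : ∀ n, Measurable (critCfgAxOfRecord F 2 (thetaFill F a₀ ε₂₉).ν (K₀ + n) 0))
    (hsol : ∀ n, ∀ W ∈ domAltOfRecord F 2 (thetaFill F a₀ ε₂₉).ν (K₀ + n) 1, UkExists F 2 (K₀ + n) 1 a₀ W)
    (hcrit : ∀ n, ContinuousOn (critCfgAxOfRecord F 2 (thetaFill F a₀ ε₂₉).ν (K₀ + n) 0) (domAltOfRecord F 2 (thetaFill F a₀ ε₂₉).ν (K₀ + n) 1)) :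
    letI θ := thetaFill F a₀ ε₂₉
    letI := θ.instVβ₁; letI := θ.instVβ₂; letI := θ.instιβ
    FormatPlusG (fun n => recordDomSys F Mc 0 (K₀ + n)) (fun n => recordBondCount F (K₀ + n)) (fun n => recordAct F (K₀ + n))
      (fun n => recordUc F Mc 0 α₀ α₁ (K₀ + n)) (fun n => recordCoords F Mc 0 (K₀ + n)) (fun n => recordChartDimJ F (K₀ + n))
      (fun n => recordChartJ F Mc 0 (K₀ + n))
      (fun n B => recordΦfAx F a₀ ε₂₉ 0 v (K₀ + n) B - recordΦzAx F a₀ ε₂₉ 0 v (K₀ + n) B)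
      (fun n => recordEmbJ F θ 0 (K₀ + n)) (fun n => recordWrapCtr F Mc 0 (K₀ + n)) (fun n => recordDomEmbCtr F Mc 0 (K₀ + n))
      (fun n _ => recordCoordProjCtr F (K₀ + n)) E κ :=
  formatPlusG_channel_zero_of_germ F a₀ ε₂₉ Mc K₀ α₀ α₁ κ E hE v fun n =>
    recordGerm_zero_of_roadB F a₀ ε₂₉ ha₀ hε29 (Nat.add_pos_left hK₀ n) v hε3 hε2 hn1 hn2 hαB hα24 hαδ hαL hBa hfed (hmeas n) (hsol n) (hcrit n)

/-- ★★★ **THE `k := 0` INSTANCE OF THE SIGNED (L) CLAUSE OF `PortZeroInputSplitZD` (26648) FROM N09's ROAD-B INPUTS, BY NAME** — binders and slots verbatim with `k := 0`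
(`recordK₀ F Mc 0 > 0` displayed as `hK₀`; `0 ≤ ρ`); the displayed hypotheses are RUN-FREE: (H-U) at level 0, the two (P0-bridge) consumers `hsol` (solvability at radius `a₀`
on `domAlt_1`) and `hcrit` (continuity of the axialised minimiser on `domAlt_1`) at every member of the family, and NUMERICS in `a₀, ε₂₉, F.L`.  Gen 2's two located riders
(ρ-b₀) ∕ (F) are no longer hypotheses. [cite: Balaban1987RG1, (0.17) p.255, (0.20) p.256, (1.18)–(1.19) p.263, (2.9) p.266–267, p.259; Balaban1985Variational, Thm 1 p.279; Balaban1988RG2Cluster, p.21] -/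
theorem portZD_histChannel_at_zero_of_roadB (ha₀ : 0 < a₀) (hε29 : 0 < ε₂₉) (Mc : ℕ) (hK₀ : 0 < recordK₀ F Mc 0) (β : FlowStep.HBeta)
    (γ₀ ρ Ē κ α₀ α₁ : ℝ) (hρ : 0 ≤ ρ)
    (hε3 : (143 * ((((8 : ℕ) : ℝ)) ^ 2 / 4) ^ 2) * a₀ ≤ 1 / 3)
    (hε2 : 2 * a₀ ≤ 2 * deltaSU (Fin 2) / (((8 * F.L : ℕ) : ℝ)) ^ 2)
    (hn1 : 1640 * (2 * ((((6 * F.L : ℕ) : ℝ)) * ε₂₉) + (((6 * F.L : ℕ) : ℝ)) ^ 2 / 4 * (2 * a₀ / (F.L : ℝ) ^ 2)) * (((F.L : ℝ) ^ 3)) ^ 2 ≤ 1)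
    (hn2 : 13 * (2 * ((((6 * F.L : ℕ) : ℝ)) * ε₂₉) + (((6 * F.L : ℕ) : ℝ)) ^ 2 / 4 * (2 * a₀ / (F.L : ℝ) ^ 2)) * (F.L : ℝ) ^ 3 < deltaSU (Fin 2))
    {α : ℝ} (hαB : (((6 * F.L : ℕ) : ℝ)) ^ 2 / 4 * (2 * a₀ / (F.L : ℝ) ^ 2 + 4 * max ε₂₉ (10 * ((((6 * F.L : ℕ) : ℝ)) * ε₂₉) * (F.L : ℝ) ^ 3)) < α)
    (hα24 : α ≤ 1 / 24) (hαδ : α < deltaSU (Fin 2)) (hαL : 157 * α < ((F.L : ℝ) ^ 3)⁻¹)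
    (hBa : 2 * a₀ / (F.L : ℝ) ^ 2 + 4 * max ε₂₉ (10 * ((((6 * F.L : ℕ) : ℝ)) * ε₂₉) * (F.L : ℝ) ^ 3) < a₀)
    (hfed : (((4 * F.L : ℕ) : ℝ)) ^ 2 / 4 * a₀ < deltaFed (Fin 2))
    (hmeas : ∀ n, Measurable (critCfgAxOfRecord F 2 (thetaFill F a₀ ε₂₉).ν (recordK₀ F Mc 0 + n) 0))
    (hsol : ∀ n, ∀ W ∈ domAltOfRecord F 2 (thetaFill F a₀ ε₂₉).ν (recordK₀ F Mc 0 + n) 1, UkExists F 2 (recordK₀ F Mc 0 + n) 1 a₀ W)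
    (hcrit : ∀ n, ContinuousOn (critCfgAxOfRecord F 2 (thetaFill F a₀ ε₂₉).ν (recordK₀ F Mc 0 + n) 0)
      (domAltOfRecord F 2 (thetaFill F a₀ ε₂₉).ν (recordK₀ F Mc 0 + n) 1)) :
    ∀ g : ℕ → ℝ, FlowStep.RGEqH 0 β g → Step.InInterval γ₀ 0 g → ∀ E : ℝ, 0 < E → E ≤ Ē →
      (∀ k₁ : ℕ, k₁ < 0 →
        letI θ := thetaFill F a₀ ε₂₉
        letI := θ.instVβ₁; letI := θ.instVβ₂; letI := θ.instιβ
        FormatPlusG (fun n => recordDomSys F Mc k₁ (recordK₀ F Mc k₁ + n)) (fun n => recordBondCount F (recordK₀ F Mc k₁ + n))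
          (fun n => recordAct F (recordK₀ F Mc k₁ + n)) (fun n => recordUc F Mc k₁ α₀ α₁ (recordK₀ F Mc k₁ + n))
          (fun n => recordCoords F Mc k₁ (recordK₀ F Mc k₁ + n)) (fun n => recordChartDimJ F (recordK₀ F Mc k₁ + n))
          (fun n => recordChartJ F Mc k₁ (recordK₀ F Mc k₁ + n))
          (fun n => recordΦfAx F a₀ ε₂₉ k₁ (FlowStep.prefixOf g k₁) (recordK₀ F Mc k₁ + n))
          (fun n => recordEmbJ F θ k₁ (recordK₀ F Mc k₁ + n)) (fun n => recordWrapCtr F Mc k₁ (recordK₀ F Mc k₁ + n))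
          (fun n => recordDomEmbCtr F Mc k₁ (recordK₀ F Mc k₁ + n)) (fun n _ => recordCoordProjCtr F (recordK₀ F Mc k₁ + n)) E κ) →
      letI θ := thetaFill F a₀ ε₂₉
      letI := θ.instVβ₁; letI := θ.instVβ₂; letI := θ.instιβ
      FormatPlusG (fun n => recordDomSys F Mc 0 (recordK₀ F Mc 0 + n)) (fun n => recordBondCount F (recordK₀ F Mc 0 + n))
        (fun n => recordAct F (recordK₀ F Mc 0 + n)) (fun n => recordUc F Mc 0 α₀ α₁ (recordK₀ F Mc 0 + n))
        (fun n => recordCoords F Mc 0 (recordK₀ F Mc 0 + n)) (fun n => recordChartDimJ F (recordK₀ F Mc 0 + n))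
        (fun n => recordChartJ F Mc 0 (recordK₀ F Mc 0 + n))
        (fun n B => recordΦfAx F a₀ ε₂₉ 0 (FlowStep.prefixOf g 0) (recordK₀ F Mc 0 + n) B -
          recordΦzAx F a₀ ε₂₉ 0 (FlowStep.prefixOf g 0) (recordK₀ F Mc 0 + n) B)
        (fun n => recordEmbJ F θ 0 (recordK₀ F Mc 0 + n)) (fun n => recordWrapCtr F Mc 0 (recordK₀ F Mc 0 + n))
        (fun n => recordDomEmbCtr F Mc 0 (recordK₀ F Mc 0 + n)) (fun n _ => recordCoordProjCtr F (recordK₀ F Mc 0 + n)) (ρ * E) κ :=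
  portZD_histChannel_at_zero_of_germ F a₀ ε₂₉ Mc β γ₀ ρ Ē κ α₀ α₁ hρ fun g _ _ n =>
    recordGerm_zero_of_roadB F a₀ ε₂₉ ha₀ hε29 (Nat.add_pos_left hK₀ n) (FlowStep.prefixOf g 0) hε3 hε2 hn1 hn2 hαB hα24 hαδ hαL hBa hfed
      (hmeas n) (hsol n) (hcrit n)

end Summit.QuantumFields.YangMills.Theorems.PortZDRecord

end
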